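import Literature.AlgebraicGeometry.Frobenioids.Thm49CompatAssembly
import Literature.AlgebraicGeometry.Frobenioids.Thm49PerfectionDescent
import Literature.AlgebraicGeometry.Frobenioids.Thm49IsotropicWLOG
import Literature.AlgebraicGeometry.Frobenioids.Thm42SubAssemblyIGeneral
import Literature.AlgebraicGeometry.Frobenioids.Cor412OfFSMType
import Literature.AlgebraicGeometry.Frobenioids.BaseCategoryTheoreticityProofs
import Literature.AlgebraicGeometry.Frobenioids.PerfectionRational
import Literature.AlgebraicGeometry.Frobenioids.PerfectionIsFrobenioid
import Literature.AlgebraicGeometry.Frobenioids.IsotropificationRational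
import HarnessLib

/-!
# [FrdI] Theorem 4.9 (Category-theoreticity of divisor monoids) — ASSEMBLY of the S5 sub-DAG
# (row `FrdI:Thm4.9/T49-L00` `Assembly49`): the typed `PreFrobenioidData.Thm49` at `ofFunctor`

Mochizuki, *The geometry of Frobenioids I: the general theory*, Kyushu J. Math. **62** (2008) 293–400,
§4, Theorem 4.9, statement p. 88 l. 33 – p. 89 l. 2, proof p. 89 l. 3 – p. 90 l. 54
[cite: MochizukiFrdI2008, Thm. 4.9 p.88] (render `paper:url-bbf705efa10f`).

PROOF-ONLY assembly (seat abc-iut-w4-d109; sub-DAG `plan/L1/SUBDAG-FrdI-Thm42-Thm49.md`, row T49-L00: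
"L01 + (L05–L08 ⇒ right = left) + L02–L04 → t3's `Thm49` closing type"). The printed proof, followed
literally: (1) "we may assume without loss of generality that `C₁`, `C₂` are of isotropic type [Thm. 3.4
(i), (ii); Rmk. 4.5.1]" — restriction `Ψ^istr : C₁^istr ⥲ C₂^istr` (`Equivalence.congrFullSubcategory`,
`FrdI.isotropicObjects_inverseImage`, seat abc-iut-L1-t13 lineage) and, at the end, row T49-L01
`FrdI.T49.nonempty_divisorMonoidIsoOver_of_isotropic` (seat abc-iut-w4-d109) with the hull clause
`FrdI.isIsotropicHull_map`; "but not of group-like type [since Theorem 4.9 is vacuous if `C₁`, `C₂` are of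
group-like type]" — `nonempty_divisorMonoidIsoOver_of_isOfGroupLikeType`; (2) "by passing to perfections
[Thm. 3.4 (iii)] … perfect type" — THE perfections `(C_i^istr)^pf` (seat abc-iut-L1-d9), `Ψ^pf`
(`Perfection.map`, seat abc-iut-L1-d1) and the setting of the proof there (`FrdI.T42.setting_perfection`, seat
abc-iut-w4-d090); (3) at the perfect-isotropic level, rows T49-L02/L05/L06/L07/L08′ as assembled by seat abc-iut-w4-d099 in
`Thm49CompatAssembly.lean` (`FrdI.T49.exists_thm49_compat_perfect_primarySupp`: Thm. 4.9 with its
`Ψ^Prime`-compatibility at a `T42.Setting`, from "`Φ₂` non-dilating" and "every universally Div-Frobenius-trivial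
object is rational"), the latter supplied by Prop. 5.5 (iii) "rational type passes to the perfection"
(`PreFrobenioid.Perfection.isRational_perfection_of`, seat abc-iut-w4-d108) and Prop. 3.2 (iii) "`C^pf` is a
Frobenioid" (`PreFrobenioid.Perfection.isFrobenioid`, seats abc-iut-L1-d1/d9); (4) the descent "`Φ₁(A₁) ⊆ Φ₁(A₁)^pf` onto `Φ₂(A₂)`" (`Thm49PerfectionDescent.lean`,
`nonempty_divisorMonoidIsoOver_of_perfection`); (5) row T49-L01.

Result `FrdI.T49.thm49_ofFunctor_of_isOfFSMType`: the typed **`PreFrobenioidData.Thm49 (ofFunctor Φ₁ F₁)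
(ofFunctor Φ₂ F₂) Ψ R₁ R₂`** (seat abc-iut-L1-t3) for Frobenioids with perf-factorial divisor monoids over
bases of FSM-type (the cell's standing route for Thm. 3.4 (ii)/(iii), finding PR-1), with the "rational
type" conjunct of "`C₁` of rationally standard type" READ AT THE CONSTRUCTIONS (`hrat₁`: every object of `C₁` is
rational at THE birationalization `PreFrobenioid.biratData` and THE support predicate `PrimarySupp` of Def. 2.4
(i)(d)) — the `IsOfRationallyStandardType R_i` hypotheses of `Thm49` quantify over data-only parameters `R_i`
(cf. `Cor412Closed.lean`) and are used through their "standard type" conjunct; the rationality transfers to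
`C₁^istr` by Rmk. 4.5.1 (`PreFrobenioid.isRational_istr_of`, `IsotropificationRational.lean`) and to
`(C₁^istr)^pf` by Prop. 5.5 (iii) (`PreFrobenioid.Perfection.isRational_perfection_of`, seat abc-iut-w4-d108).

No new definitions; no statement of the paper is strengthened; nothing here bears on [IUTchIII] Cor. 3.12.
-/

namespace Literature.AlgebraicGeometry.Frobenioids

namespace FrdI.T49

open CategoryTheory Opposite PreFrobenioidData

universe w v v' u u'

variable {D₁ : Type u} [Category.{v} D₁] {Φ₁ : D₁ᵒᵖ ⥤ CommMonCat.{w}} {C₁ : Type u'} [Category.{v'} C₁]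
  {D₂ : Type u} [Category.{v} D₂] {Φ₂ : D₂ᵒᵖ ⥤ CommMonCat.{w}} {C₂ : Type u'} [Category.{v'} C₂]
  {F₁ : C₁ ⥤ ElemFrobenioid Φ₁} {F₂ : C₂ ⥤ ElemFrobenioid Φ₂}

/-- "since Theorem 4.9 is vacuous if `C₁`, `C₂` are of group-like type" (p. 89 l. 5), made precise: over bases
of FSM-type and in quasi-isotropic type, if `C₁` is of group-like type then so is `C₂` (Thm. 3.4 (ii):
`Ψ` carries group-like objects to group-like objects; every object of `C₂` is isomorphic to a `Ψ A`).
[cite: MochizukiFrdI2008, Thm. 4.9 p.89] -/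
theorem isOfGroupLikeType_of_equivalence (hF₁ : PreFrobenioid.IsFrobenioid F₁)
    (hF₂ : PreFrobenioid.IsFrobenioid F₂) (hq₁ : (ofFunctor Φ₁ F₁).IsOfQuasiIsotropicType)
    (hq₂ : (ofFunctor Φ₂ F₂).IsOfQuasiIsotropicType) (hD₁ : IsOfFSMType D₁) (Ψ : C₁ ≌ C₂)
    (h₁ : (ofFunctor Φ₁ F₁).IsOfGroupLikeType) : (ofFunctor Φ₂ F₂).IsOfGroupLikeType := by
  refine ⟨fun B => (ofFunctor_isGroupLikeObj F₂ B).2 ?_⟩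
  have hB' : PreFrobenioid.IsGroupLikeObj F₂ (Ψ.functor.obj (Ψ.inverse.obj B)) :=
    FrdI.isGroupLikeObj_map_of_quasiIsotropic_of_isOfFSMType hF₁ hF₂ hq₁ hq₂ hD₁ Ψ
      ((ofFunctor_isGroupLikeObj F₁ _).1 (h₁.obj _))
  exact FrdI.isGroupLikeObj_of_isBaseIso hF₂.isPreFrobenioid (Ψ.counitIso.app B).hom hB'

/-- A non-group-like object of `C` has a non-group-like isotropic hull, an object of `C^istr` (the hull
`A → A^istr` is a pre-step, so `Φ(A) ≅ Φ(A^istr)`; Def. 1.2 (iv), Def. 1.3 (vii)(a)).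
[cite: MochizukiFrdI2008, Thm. 4.9 p.89] -/
theorem not_isGroupLikeObj_hullIstr (hF₁ : PreFrobenioid.IsFrobenioid F₁) {N : C₁}
    (hN : ¬ PreFrobenioid.IsGroupLikeObj F₁ N) :
    ¬ PreFrobenioid.IsGroupLikeObj (PreFrobenioid.istrFunctor F₁) (PreFrobenioid.hullIstr hF₁ N) :=
  fun h => hN (FrdI.isGroupLikeObj_of_isBaseIso' hF₁.isPreFrobenioid (PreFrobenioid.hullHom hF₁ N)
    (PreFrobenioid.isIsotropicHull_hullHom hF₁ N).2.1.2 h)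

/-- **[FrdI] Theorem 4.9 AS TYPED (`PreFrobenioidData.Thm49` at `ofFunctor`)**, for Frobenioids
`C_i → F_{Φ_i}` with perf-factorial `Φ_i` over bases of FSM-type, with `C₁` of rational type at THE
birationalization / support (`hrat₁`): for `C_i` of rationally standard type there is an isomorphism of
functors `Ψ^Φ : Φ₁ ⥲ Φ₂` lying over `Ψ`. Proof = the printed one: isotropifications (Thm. 3.4 (i)) and their
non-group-like objects, perfections (Thm. 3.4 (iii); Prop. 3.2 (iii) `Perfection.isFrobenioid`), rationality
of the isotropification (Rmk. 4.5.1, `isRational_istr_of`) and of the perfection (Prop. 5.5 (iii),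
`Perfection.isRational_perfection_of`), Thm. 4.9 at the perfect-isotropic level (rows T49-L02/L05/L06/L07/L08′,
`exists_thm49_compat_perfect_primarySupp`), descent along `Φ ↪ Φ^pf` (`nonempty_divisorMonoidIsoOver_of_perfection`),
extension along isotropic hulls (row T49-L01); the group-like case is the trivial isomorphism.
[cite: MochizukiFrdI2008, Thm. 4.9 p.88] -/
theorem thm49_ofFunctor_of_isOfFSMType (hF₁ : PreFrobenioid.IsFrobenioid F₁)
    (hF₂ : PreFrobenioid.IsFrobenioid F₂) (hD₁ : IsOfFSMType D₁) (hD₂ : IsOfFSMType D₂)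
    (hpf₁ : Objectwise (fun M _ => IsPerfFactorial M) Φ₁) (hpf₂ : Objectwise (fun M _ => IsPerfFactorial M) Φ₂)
    (hrat₁ : ∀ A : C₁, PreFrobenioidData.IsRational
      (PreFrobenioid.biratData hF₁ (PreFrobenioid.hasBiratSquares_of_isFrobenioid hF₁))
      (S := ofFunctor Φ₁ F₁) (fun a 𝔭 => PrimarySupp a 𝔭) A)
    (Ψ : C₁ ≌ C₂) (R₁ : (ofFunctor Φ₁ F₁).RSParams) (R₂ : (ofFunctor Φ₂ F₂).RSParams) :
    (ofFunctor Φ₁ F₁).Thm49 (ofFunctor Φ₂ F₂) Ψ R₁ R₂ := by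
  intro hR₁ hR₂
  have hs₁ := hR₁.standard
  have hs₂ := hR₂.standard
  have hP₁ := hF₁.isPreFrobenioid
  have hP₂ := hF₂.isPreFrobenioid
  have hq₁ := hs₁.quasiIsotropic
  have hq₂ := hs₂.quasiIsotropic
  -- "Theorem 4.9 is vacuous if `C₁`, `C₂` are of group-like type": the trivial isomorphism
  by_cases hg₁ : (ofFunctor Φ₁ F₁).IsOfGroupLikeType
  · exact nonempty_divisorMonoidIsoOver_of_isOfGroupLikeType F₁ F₂ Ψ hg₁
      (isOfGroupLikeType_of_equivalence hF₁ hF₂ hq₁ hq₂ hD₁ Ψ hg₁)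
  -- non-group-like objects `N₁`, `Ψ N₁`
  obtain ⟨N₁, hN₁⟩ : ∃ A : C₁, ¬ PreFrobenioid.IsGroupLikeObj F₁ A := by
    by_contra h
    exact hg₁ ⟨fun A => (ofFunctor_isGroupLikeObj F₁ A).2 (not_exists_not.mp h A)⟩
  have hN₂ : ¬ PreFrobenioid.IsGroupLikeObj F₂ (Ψ.functor.obj N₁) := fun h =>
    hN₁ (FrdI.isGroupLikeObj_of_isBaseIso' hP₁ (Ψ.unitIso.app N₁).hom
      (PreFrobenioid.isBaseIso_of_isIso F₁ _)
      (FrdI.isGroupLikeObj_map_of_quasiIsotropic_of_isOfFSMType hF₂ hF₁ hq₂ hq₁ hD₂ Ψ.symm h))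
  -- (1) the isotropifications `C_i^istr` and the restriction `Ψ^istr` (Thm. 3.4 (i), Rmk. 4.5.1)
  haveI : (PreFrobenioid.isotropicObjects F₂).IsClosedUnderIsomorphisms :=
    ⟨fun e hX => PreFrobenioid.IsIsotropic.of_iso hP₂ e.symm hX⟩
  have hinvImg := FrdI.isotropicObjects_inverseImage hF₁ hq₁ hq₂ Ψ
  let Ψi : PreFrobenioid.Istr F₁ ≌ PreFrobenioid.Istr F₂ := Ψ.congrFullSubcategory hinvImg
  have hI₁ := PreFrobenioid.isFrobenioid_istr hF₁
  have hI₂ := PreFrobenioid.isFrobenioid_istr hF₂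
  have hsI₁ := PreFrobenioid.isOfStandardType_istr hF₁ hs₁
  have hsI₂ := PreFrobenioid.isOfStandardType_istr hF₂ hs₂
  have hnd₁ : IsNonDilatingOn Φ₁ := FrdI.isNonDilatingOn_of_ofFunctor hs₁.nonDilating
  have hnd₂ : IsNonDilatingOn Φ₂ := FrdI.isNonDilatingOn_of_ofFunctor hs₂.nonDilating
  have hNI₁ := not_isGroupLikeObj_hullIstr hF₁ hN₁
  have hNI₂ := not_isGroupLikeObj_hullIstr hF₂ hN₂
  -- Thm. 3.4 (iii) for `Ψ^istr`: compatible with arrows of Frobenius type; Thm. 3.4 (ii): `(Ψ^istr)⁻¹`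
  -- preserves pre-steps
  have hΨi : PreFrobenioid.IsFrobeniusCompatible (PreFrobenioid.istrFunctor F₁)
      (PreFrobenioid.istrFunctor F₂) Ψi.functor :=
    FrdI.T42.isFrobeniusCompatible_of_isOfFSMType Ψi hI₁ hI₂ hsI₁.quasiIsotropic hsI₂.quasiIsotropic
      hnd₁ hnd₂ hD₁ hD₂ hNI₁ hNI₂
  have hinvI : ∀ ⦃X Y : PreFrobenioid.Istr F₂⦄ (g : X ⟶ Y),
      PreFrobenioid.IsPreStep (PreFrobenioid.istrFunctor F₂) g →
        PreFrobenioid.IsPreStep (PreFrobenioid.istrFunctor F₁) (Ψi.inverse.map g) :=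
    fun X Y g hg => FrdI.isPreStep_map_of_quasiIsotropic_of_isOfFSMType hI₂ hI₁ hsI₂.quasiIsotropic
      hsI₁.quasiIsotropic hD₁ Ψi.symm hg
  -- (2) the perfections `(C_i^istr)^pf` (Frobenioids: Prop. 3.2 (iii)) and the setting of the proof there
  have hPf₁ := PreFrobenioid.Perfection.isFrobenioid hI₁
    (FrdI.T42.isFrobeniusIsotropic_of_isOfIsotropicType hI₁ PreFrobenioid.isOfIsotropicType_istr)
  have hPf₂ := PreFrobenioid.Perfection.isFrobenioid hI₂
    (FrdI.T42.isFrobeniusIsotropic_of_isOfIsotropicType hI₂ PreFrobenioid.isOfIsotropicType_istr)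
  haveI := PreFrobenioid.Perfection.map_isEquivalence (hF₁ := hI₁) (hF₂ := hI₂) Ψi hΨi
  have S := FrdI.T42.setting_perfection Ψi hI₁ hI₂ hPf₁ hPf₂ PreFrobenioid.isOfIsotropicType_istr
    PreFrobenioid.isOfIsotropicType_istr hpf₁ hpf₂ hsI₁.nonDilating hsI₂.nonDilating hD₁ hD₂ hNI₁ hNI₂ hΨi
  have hndp₂ : IsNonDilatingOn (PreFrobenioid.Perfection.ops hI₂).monFunctor :=
    FrdI.isNonDilatingOn_of_ofFunctor (F := (PreFrobenioid.Perfection.ops hI₂).toFunctor)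
      (PreFrobenioid.Perfection.isNonDilatingOn_ops hI₂ hsI₂.nonDilating)
  -- Rmk. 4.5.1: `C₁^istr` is of rational type; Prop. 5.5 (iii): so is `(C₁^istr)^pf`
  have hratI : ∀ A : PreFrobenioid.Istr F₁, PreFrobenioidData.IsRational
      (PreFrobenioid.biratData hI₁ (PreFrobenioid.hasBiratSquares_of_isFrobenioid hI₁))
      (S := ofFunctor Φ₁ (PreFrobenioid.istrFunctor F₁)) (fun a 𝔭 => PrimarySupp a 𝔭) A :=
    fun A => PreFrobenioid.isRational_istr_of hF₁ hrat₁ A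
  have hratP : ∀ ⦃X : PreFrobenioid.Perfection hI₁⦄,
      PreFrobenioid.IsUniversallyDivFrobeniusTrivial (PreFrobenioid.Perfection.ops hI₁).toFunctor X →
        PreFrobenioidData.IsRational (PreFrobenioid.biratData S.isFrobenioid₁
          (PreFrobenioid.hasBiratSquares_of_isFrobenioid S.isFrobenioid₁))
          (S := ofFunctor _ (PreFrobenioid.Perfection.ops hI₁).toFunctor) (fun a 𝔭 => PrimarySupp a 𝔭) X :=
    fun X _ => PreFrobenioid.Perfection.isRational_perfection_of hI₁ hPf₁ hratI X
  -- (3) Thm. 4.9 at the perfect-isotropic level (rows T49-L02/L05/L06/L07/L08′ with `Ψ^Prime`)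
  obtain ⟨E', -, -, hE', -⟩ := exists_thm49_compat_perfect_primarySupp S hndp₂ hratP
  -- (4) descent along `Φ_i ↪ Φ_i^pf` to the isotropifications
  obtain ⟨EI⟩ := nonempty_divisorMonoidIsoOver_of_perfection hI₁ hI₂ Ψi hΨi hinvI E'
    (fun X Y f hf => hE' f hf)
  -- (5) extension along isotropic hulls (row T49-L01)
  exact nonempty_divisorMonoidIsoOver_of_isotropic F₁ F₂ Ψ hF₁ hF₂
    (fun A hA => FrdI.isIsotropic_map hq₁ hq₂ Ψ hA)
    (fun A B h hh => FrdI.isIsotropicHull_map hF₁ hF₂ hq₁ hq₂ Ψ hh)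
    (fun A hA => EI.iso ⟨A, hA⟩)
    (fun A B hA hB φ x =>
      EI.natural (A := (⟨A, hA⟩ : PreFrobenioid.Istr F₁)) (B := ⟨B, hB⟩) (ObjectProperty.homMk φ) x)

end FrdI.T49

end Literature.AlgebraicGeometry.Frobenioids
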